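import Summits.HodgeConjecture.HodgeConjecture.Theorems.VHCAbelianSchemesRoadSplitWeilTensorAnchors
import HarnessLib

/-!
# Road b02 (`VHCAbelianSchemesRoad`) × the André column — the split-Weil axis GRADED BY CELL: which ONE cell `(2p·e₀, p)` of the Weil-tensor node over
# `E₀` serves which sector `(p, [E:ℚ] = 2e₀)` of `AndreSplitWeilClasses` (quartic eightfolds in codimension 2 from cell `(8,2)`; quadratic split
# eightfolds from `(8,4)`; quadratic split sixfolds — Markman's sector — from `(6,3)`)

research route, not a corollary; conditional on HC_CM plus one named minimal statement.

PART AD-a (`VHCAbelianSchemesRoadSplitWeilTensorAnchors`) proved: the tensor form of Lemme 6.3.3 ∧ the door ∧ Weil-tensor carriers over ONE elliptic curve at ALL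
cells `2 ≤ p ≤ d − 2` ⟹ every rational Weil class of every split `E`-Weil structure is algebraic. Its per-pencil engine consumes the carrier statement at ONE
cell only — the cell `(d, p)` of the pencil, and André's pencil for a datum `(B, η, R, e₀, p, …)` has `d = dim B = 2p·e₀`. This file records the grading
(fact-free apart from the displayed named fact; route-free):

* §1 **graded engine and graded split row**: `IsWeilTensorAnchoredPencilFor E₀ B' p w f d` ∧ the door ∧ the Weil-tensor carrier statement AT THE CELL `(d, p)`
  ALONE (asked only when `2 ≤ p ≤ d − 2`) ⟹ `w` algebraic; hence for a split datum with parameters `(p, e₀)`, `p ≥ 2`: the cell `(2p·e₀, p)` alone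
  (`splitWeilClass_mem_algebraicClasses_of_weilTensorPencil_of_door_of_cellCarrierAt`), and the `W_E ⊗ ℂ ≤ algebraicClasses` form;
* §2 **the three smallest open sectors as single cells** of the node «carriers for `E'`-Weil classes of CM-field structures on polarised abelian `n`-folds
  isogenous to powers of `E₀`» (`AnchoredCarrierAt 𝒪 n p (ellipticPowerPolarisedAnchorOf E₀ n) (weilStructureServedClasses n p)`; at `(n, p)` only
  structures with `n = p·[E':ℚ]` are served, so the cell `(8,2)` serves QUARTIC structures only, `(8,4)` and `(6,3)` imaginary QUADRATIC ones only):
  — `(p, e₀) = (2, 2)`: **codimension-2 Weil classes on split Weil EIGHTFOLDS with multiplication by a QUARTIC CM field** (the habitat of the cell's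
    K3-partner eightfolds `Y × Z²`; «not known to be algebraic (nor Künneth-algebraic)» for `E⁺ ≠ ℚ`, André 2026 §4.4.4) ⟸ door ∧ cell `(8, 2)` over `E₀`;
  — `(p, e₀) = (4, 1)`: **Weil classes on split Weil EIGHTFOLDS, `K` imaginary quadratic** (the ladder's R2₈ sector in André's format; «dimension `≥ 8`:
    nothing is known for any `K`», Markman §1.2) ⟸ door ∧ cell `(8, 4)` over `E₀`;
  — `(p, e₀) = (3, 1)`: **Weil classes on split Weil SIXFOLDS, `K` imaginary quadratic** (Markman's Thm. 1.5.1 sector, PREPRINT) ⟸ door ∧ cell `(6, 3)` over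
    `E₀` — compare the road's crux cell `(6,3)` (a datum at SOME fibre of EVERY pencil): here a datum for every `K`-Weil class of every quadratic structure
    on the polarised sixfolds isogenous to `E₀⁶` only.

HONEST: the named fact is a THEOREM IN PRINT entering BY NAME; every carrier statement is OPEN, not in print and NOT implied by the Hodge conjecture; the door is
the road's binder (labels: route file, RING2-MAP AA2.487). The grading is bookkeeping of AD-a's proof, not new mathematics. Nothing here says any carrier, door,
Weil class, `HC_CM`, `HC_AV` or HC holds. References: [cite: Andre1996Motifs, §6.3 b)–c), Lemme 6.3.3 and proof (pp. 32–33)] [cite: Andre2026, §4.4.4]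
[cite: Markman2025SecantWeil, §1.2 and Thm. 1.5.1] [cite: MoonenZarhin1998WeilClasses, §1] [cite: Bloch1972Semiregularity, Remark (7.5)]
[cite: BuchweitzFlenner2003, §5 Thm. 5.1].
-/

noncomputable section

open CategoryTheory CategoryTheory.Limits AlgebraicGeometry Topology

namespace Summit.HodgeConjecture.HodgeConjecture.Ring2.SemiregularRepresentatives

-- the cell's namespace repeats the summit name (`Summit.HodgeConjecture.HodgeConjecture…`), as in every `Ring2*` file
set_option linter.dupNamespace false

open Literature.AlgebraicGeometry Literature.AlgebraicGeometry.Motives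
open Literature.AlgebraicGeometry.HodgeTheory
open Literature.AlgebraicGeometry.Deligne1982
open Literature.AlgebraicGeometry.VanGeemen1994 (pullbackOne)
open Literature.AlgebraicTopology.SingularHomology
open Literature.Barriers.HodgeConjecture (divisorClassesSpan)
open Literature.AlgebraicGeometry.Andre1996 (andre1996_splitWeilClasses_weilTensorPencil IsWeilTensorAnchoredPencilFor)
open Summit.Ventures.HSemireg (ObjClass LocalVariationalHodgeFor)
open Summit.HodgeConjecture.HodgeConjecture.Ring2.AbelianAll (ellipticPowerPolarisedAnchorOf weilStructureServedClasses)

variable {𝒪 : ObjClass}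

/-! ## §1 The graded engine and the graded split row -/

/-- **GRADED ENGINE: the cell `(d, p)` of the pencil alone.** The door for `𝒪` ∧ the Weil-tensor carrier statement over `E₀` at the ONE cell `(d, p)` (asked only
in the mid-range `2 ≤ p ≤ d − 2`) ∧ `IsWeilTensorAnchoredPencilFor E₀ B' p w f d` ⟹ `w ∈ algebraicClasses B'.X p` (AD-a's engine reads the blanket hypothesis at
this cell only). [cite: Andre1996Motifs, Lemme 6.3.3 and proof (p. 33)] [cite: BuchweitzFlenner2003, §5 Thm. 5.1] -/
theorem mem_algebraicClasses_of_isWeilTensorAnchoredPencilFor_of_door_of_cellCarrierAt (hT : LocalVariationalHodgeFor 𝒪) {E₀ : AbelianVariety ℂ}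
    {B' : AbelianVariety ℂ} {p : ℕ} {w : complexBetti B'.X (2 * p)} {𝒳 S : SchemeOver ℂ} {f : 𝒳 ⟶ S} {d : ℕ}
    (hcar : 2 ≤ p → p + 2 ≤ d → AnchoredCarrierAt 𝒪 d p (ellipticPowerPolarisedAnchorOf E₀ d) (weilStructureServedClasses d p))
    (hf : IsWeilTensorAnchoredPencilFor E₀ B' p w f d) : w ∈ algebraicClasses B'.X p := by
  obtain ⟨hf, s₁, s₀, W, A₁, e₁, g', q, hW, hq, hgw, -, A₀, e₀, N, ψ₀, hiso, hweil⟩ := hf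
  have h₁ : complexBetti.map (fiberι f s₁) (2 * p) W ∈ algebraicClasses (fiberOver f s₁) p := by
    by_cases hoff : p ≤ 1 ∨ d ≤ p + 1
    · exact (mem_algebraicClasses_and_divisorClassesSpan_of_offMidRange (hf.isSmoothProjectiveFamily.isSmoothProjective s₁) hoff _
        (hW s₁).1 (hW s₁).2).1
    · exact mem_algebraicClasses_compactPencil_of_anchoredCarrierAt_of_hasServedFibre hT (hcar (by omega) (by omega)) hf W hW
        (hasServedFibre_compactPencil_of_weilTensorFibre hf e₀ ψ₀ hiso W hW hweil) s₁
  have h₂ : complexBetti.map e₁.hom (2 * p) (complexBetti.map (fiberι f s₁) (2 * p) W) ∈ algebraicClasses A₁.X p :=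
    (mem_algebraicClasses_map_iff_of_iso e₁).2 h₁
  have h₃ : (q : ℂ) • w ∈ algebraicClasses B'.X p := by
    rw [← hgw]
    exact map_mem_algebraicClasses_of_abelianVariety AbelianVariety.isSmoothProjective_holds A₁ g'.hom.hom.hom h₂
  exact (Submodule.smul_mem_iff _ (Rat.cast_ne_zero.2 hq)).1 h₃

section Split

variable {B : AbelianVariety ℂ} {η : B ⟶ B} {R : Polynomial ℤ} {e₀ p : ℕ}
  {e : ProjectiveEmbedding B.X} {a : complexBetti (projectiveSpace e.n ℂ) 2}
  {w : complexBetti B.X (2 * p)}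

/-- **GRADED SPLIT ROW: the sector `(p, e₀)` from the ONE cell `(2p·e₀, p)`.** The tensor fact ∧ the door for `𝒪` ∧ an elliptic curve `E₀` with the Weil-tensor
carrier statement at the cell `(2p·e₀, p)` ⟹ every rational Weil class of every split `E`-Weil datum with `dim_E H¹ = 2p`, `[E:ℚ] = 2e₀`, `p ≥ 2`, is algebraic
(André's pencil has relative dimension `dim B = 2p·e₀`, `IsWeilTypeCM.dim_eq`). [cite: Andre1996Motifs, §6.3 b)–c) (pp. 32–33)] [cite: Bloch1972Semiregularity, Remark (7.5)] -/
theorem splitWeilClass_mem_algebraicClasses_of_weilTensorPencil_of_door_of_cellCarrierAt (h : andre1996_splitWeilClasses_weilTensorPencil)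
    (hT : LocalVariationalHodgeFor 𝒪) {E₀ : AbelianVariety ℂ} (hE₀ : E₀.dim = 1)
    (hcar : AnchoredCarrierAt 𝒪 (2 * p * e₀) p (ellipticPowerPolarisedAnchorOf E₀ (2 * p * e₀)) (weilStructureServedClasses (2 * p * e₀) p))
    (hB : IsWeilTypeCM B η R e₀ p) (hp : 2 ≤ p) (ha : IsRationalClass a) (ha₀ : a ≠ 0)
    (hRos : ∀ x y : complexBetti B.X 1,
      polarizationPairingOne B.X (complexBetti.map e.ι 2 a) (B.dim - 1) (pullbackOne B η x) y =
        -polarizationPairingOne B.X (complexBetti.map e.ι 2 a) (B.dim - 1) x (pullbackOne B η y))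
    (hsplit : IsHyperbolicWeilType B η (p * e₀) (complexBetti.map e.ι 2 a))
    (hw : w ∈ weilClassesField B η (R.comp (Polynomial.X ^ 2)) (2 * p)) (hwQ : IsRationalClass w) :
    w ∈ algebraicClasses B.X p := by
  obtain ⟨𝒳, S, f, hf⟩ := h E₀ hE₀ R e₀ p hp 1 (fun _ => B) (fun _ => η) (fun _ => e) (fun _ => a)
    (fun _ => w) (fun _ => hB) (fun _ => ⟨ha, ha₀⟩) (fun _ => hRos) (fun _ => hsplit) (fun _ => hw) (fun _ => hwQ)
  refine mem_algebraicClasses_of_isWeilTensorAnchoredPencilFor_of_door_of_cellCarrierAt hT (fun _ _ ↦ ?_) (hf 0)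
  rw [hB.dim_eq]
  exact hcar

/-- **Graded, the whole line**: under the same hypotheses on `(B, η, h)`, `W_E ⊗ ℂ ≤ algebraicClasses B.X p` from the cell `(2p·e₀, p)` alone.
[cite: MoonenZarhin1998WeilClasses, §1 Lemma (1)] [cite: Andre1996Motifs, §6.3 c) (p. 33)] -/
theorem weilClassesField_le_algebraicClasses_of_split_of_weilTensorPencil_of_door_of_cellCarrierAt (h : andre1996_splitWeilClasses_weilTensorPencil)
    (hT : LocalVariationalHodgeFor 𝒪) {E₀ : AbelianVariety ℂ} (hE₀ : E₀.dim = 1)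
    (hcar : AnchoredCarrierAt 𝒪 (2 * p * e₀) p (ellipticPowerPolarisedAnchorOf E₀ (2 * p * e₀)) (weilStructureServedClasses (2 * p * e₀) p))
    (hB : IsWeilTypeCM B η R e₀ p) (hp : 2 ≤ p) (ha : IsRationalClass a) (ha₀ : a ≠ 0)
    (hRos : ∀ x y : complexBetti B.X 1,
      polarizationPairingOne B.X (complexBetti.map e.ι 2 a) (B.dim - 1) (pullbackOne B η x) y =
        -polarizationPairingOne B.X (complexBetti.map e.ι 2 a) (B.dim - 1) x (pullbackOne B η y))
    (hsplit : IsHyperbolicWeilType B η (p * e₀) (complexBetti.map e.ι 2 a)) :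
    weilClassesField B η (R.comp (Polynomial.X ^ 2)) (2 * p) ≤ algebraicClasses B.X p :=
  hB.weilClassesField_le_algebraicClasses_of_forall_isRationalClass fun _ hc hcQ ↦
    splitWeilClass_mem_algebraicClasses_of_weilTensorPencil_of_door_of_cellCarrierAt h hT hE₀ hcar hB hp ha ha₀ hRos hsplit hc hcQ

end Split

/-! ## §2 The three smallest open sectors as single cells of the Weil-tensor node over `E₀` -/

section Sectors

variable {B : AbelianVariety ℂ} {η : B ⟶ B} {R : Polynomial ℤ}
  {e : ProjectiveEmbedding B.X} {a : complexBetti (projectiveSpace e.n ℂ) 2}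

/-- **QUARTIC CM FIELD, SPLIT WEIL EIGHTFOLDS, CODIMENSION 2 ⟸ door ∧ the cell `(8, 2)` over `E₀`.** For every split `E`-Weil datum with `[E:ℚ] = 4` (`e₀ = 2`)
and `dim_E H¹ = 4` (`p = 2`) — `dim B = 8`, the habitat of the K3-partner eightfolds `Y × Z²` — the codimension-2 line `W_E ⊗ ℂ` is algebraic, granted the tensor
fact, the door, and carriers for the codimension-2 Weil classes of QUARTIC CM-field structures (the only ones served at `(8,2)`: `8 = 2·[E':ℚ]`) on polarised
abelian eightfolds isogenous to `E₀⁸`. In print: «not known to be algebraic (nor Künneth-algebraic)» for `E⁺ ≠ ℚ` (André 2026 §4.4.4); Markman §12.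
[cite: Andre2026, §4.4.4] [cite: Andre1996Motifs, Lemme 6.3.3 (p. 33)] [cite: Markman2025SurveySecant, §12] [cite: Bloch1972Semiregularity, Remark (7.5)] -/
theorem weilClassesField_le_algebraicClasses_quarticSplitEightfold_of_door_of_cell_eight_two (h : andre1996_splitWeilClasses_weilTensorPencil)
    (hT : LocalVariationalHodgeFor 𝒪) {E₀ : AbelianVariety ℂ} (hE₀ : E₀.dim = 1)
    (hcar : AnchoredCarrierAt 𝒪 8 2 (ellipticPowerPolarisedAnchorOf E₀ 8) (weilStructureServedClasses 8 2))
    (hB : IsWeilTypeCM B η R 2 2) (ha : IsRationalClass a) (ha₀ : a ≠ 0)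
    (hRos : ∀ x y : complexBetti B.X 1,
      polarizationPairingOne B.X (complexBetti.map e.ι 2 a) (B.dim - 1) (pullbackOne B η x) y =
        -polarizationPairingOne B.X (complexBetti.map e.ι 2 a) (B.dim - 1) x (pullbackOne B η y))
    (hsplit : IsHyperbolicWeilType B η (2 * 2) (complexBetti.map e.ι 2 a)) :
    weilClassesField B η (R.comp (Polynomial.X ^ 2)) (2 * 2) ≤ algebraicClasses B.X 2 :=
  weilClassesField_le_algebraicClasses_of_split_of_weilTensorPencil_of_door_of_cellCarrierAt h hT hE₀ hcar hB le_rfl ha ha₀ hRos hsplit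

/-- **IMAGINARY QUADRATIC `K`, SPLIT WEIL EIGHTFOLDS ⟸ door ∧ the cell `(8, 4)` over `E₀`** (the ladder's R2₈ sector in André's format — `e₀ = 1`, `p = 4`,
`dim B = 8`; «in dimension `≥ 8` nothing is known for any `K`», Markman §1.2): `W_K ⊗ ℂ ≤ algebraicClasses B.X 4`, granted the tensor fact, the door, and carriers for
the codimension-4 Weil classes of imaginary QUADRATIC structures on polarised abelian eightfolds isogenous to `E₀⁸`.
[cite: Markman2025SecantWeil, §1.2] [cite: Andre1996Motifs, Lemme 6.3.3 (p. 33)] [cite: Bloch1972Semiregularity, Remark (7.5)] -/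
theorem weilClassesField_le_algebraicClasses_quadraticSplitEightfold_of_door_of_cell_eight_four (h : andre1996_splitWeilClasses_weilTensorPencil)
    (hT : LocalVariationalHodgeFor 𝒪) {E₀ : AbelianVariety ℂ} (hE₀ : E₀.dim = 1)
    (hcar : AnchoredCarrierAt 𝒪 8 4 (ellipticPowerPolarisedAnchorOf E₀ 8) (weilStructureServedClasses 8 4))
    (hB : IsWeilTypeCM B η R 1 4) (ha : IsRationalClass a) (ha₀ : a ≠ 0)
    (hRos : ∀ x y : complexBetti B.X 1,
      polarizationPairingOne B.X (complexBetti.map e.ι 2 a) (B.dim - 1) (pullbackOne B η x) y =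
        -polarizationPairingOne B.X (complexBetti.map e.ι 2 a) (B.dim - 1) x (pullbackOne B η y))
    (hsplit : IsHyperbolicWeilType B η (4 * 1) (complexBetti.map e.ι 2 a)) :
    weilClassesField B η (R.comp (Polynomial.X ^ 2)) (2 * 4) ≤ algebraicClasses B.X 4 :=
  weilClassesField_le_algebraicClasses_of_split_of_weilTensorPencil_of_door_of_cellCarrierAt h hT hE₀ hcar hB (by norm_num) ha ha₀ hRos hsplit

/-- **IMAGINARY QUADRATIC `K`, SPLIT WEIL SIXFOLDS ⟸ door ∧ the cell `(6, 3)` over `E₀`** (Markman's Thm. 1.5.1 sector — PREPRINT — in André's format; `e₀ = 1`,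
`p = 3`): `W_K ⊗ ℂ ≤ algebraicClasses B.X 3`, granted the tensor fact, the door, and carriers for the codimension-3 Weil classes of imaginary quadratic structures on
polarised abelian sixfolds isogenous to `E₀⁶` — a per-variety statement at ONE isogeny class of sixfolds per `E₀`, to be compared with the road's crux cell `(6,3)`
(a datum at SOME fibre of EVERY one-parameter abelian scheme). [cite: Markman2025SecantWeil, Thm. 1.5.1 and §1.5] [cite: Andre1996Motifs, Lemme 6.3.3 (p. 33)]
[cite: Bloch1972Semiregularity, Remark (7.5)] -/
theorem weilClassesField_le_algebraicClasses_quadraticSplitSixfold_of_door_of_cell_six_three (h : andre1996_splitWeilClasses_weilTensorPencil)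
    (hT : LocalVariationalHodgeFor 𝒪) {E₀ : AbelianVariety ℂ} (hE₀ : E₀.dim = 1)
    (hcar : AnchoredCarrierAt 𝒪 6 3 (ellipticPowerPolarisedAnchorOf E₀ 6) (weilStructureServedClasses 6 3))
    (hB : IsWeilTypeCM B η R 1 3) (ha : IsRationalClass a) (ha₀ : a ≠ 0)
    (hRos : ∀ x y : complexBetti B.X 1,
      polarizationPairingOne B.X (complexBetti.map e.ι 2 a) (B.dim - 1) (pullbackOne B η x) y =
        -polarizationPairingOne B.X (complexBetti.map e.ι 2 a) (B.dim - 1) x (pullbackOne B η y))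
    (hsplit : IsHyperbolicWeilType B η (3 * 1) (complexBetti.map e.ι 2 a)) :
    weilClassesField B η (R.comp (Polynomial.X ^ 2)) (2 * 3) ≤ algebraicClasses B.X 3 :=
  weilClassesField_le_algebraicClasses_of_split_of_weilTensorPencil_of_door_of_cellCarrierAt h hT hE₀ hcar hB (by norm_num) ha ha₀ hRos hsplit

end Sectors

/-! ## §3 Twisted-door form of the graded row, per `C` -/

/-- **Twisted-door form of the graded split row, per `C`** (route binder `TwistedPerfectDoorVHC C Adm` by name).
[cite: Andre1996Motifs, Lemme 6.3.3 (p. 33)] [cite: Pridham2024Semiregularity, Cor. 2.25 and Rem. 2.26–2.27] [cite: BuchweitzFlenner2003, §5 Thm. 5.1] -/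
theorem weilClassesField_le_algebraicClasses_of_split_of_weilTensorPencil_of_twistedPerfectDoorVHC_of_cellCarrierAt {C : ChernCharacterBetti}
    {Adm : PerfectAdmissibility} (h : andre1996_splitWeilClasses_weilTensorPencil) (hT : TwistedPerfectDoorVHC C Adm) {E₀ : AbelianVariety ℂ}
    (hE₀ : E₀.dim = 1) {B : AbelianVariety ℂ} {η : B ⟶ B} {R : Polynomial ℤ} {e₀ p : ℕ} {e : ProjectiveEmbedding B.X}
    {a : complexBetti (projectiveSpace e.n ℂ) 2}
    (hcar : AnchoredCarrierAt (twistedReflexiveClass C Adm) (2 * p * e₀) p (ellipticPowerPolarisedAnchorOf E₀ (2 * p * e₀))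
      (weilStructureServedClasses (2 * p * e₀) p))
    (hB : IsWeilTypeCM B η R e₀ p) (hp : 2 ≤ p) (ha : IsRationalClass a) (ha₀ : a ≠ 0)
    (hRos : ∀ x y : complexBetti B.X 1,
      polarizationPairingOne B.X (complexBetti.map e.ι 2 a) (B.dim - 1) (pullbackOne B η x) y =
        -polarizationPairingOne B.X (complexBetti.map e.ι 2 a) (B.dim - 1) x (pullbackOne B η y))
    (hsplit : IsHyperbolicWeilType B η (p * e₀) (complexBetti.map e.ι 2 a)) :
    weilClassesField B η (R.comp (Polynomial.X ^ 2)) (2 * p) ≤ algebraicClasses B.X p :=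
  weilClassesField_le_algebraicClasses_of_split_of_weilTensorPencil_of_door_of_cellCarrierAt h
    ((twistedPerfectDoorVHC_iff_localVariationalHodgeFor C Adm).1 hT) hE₀ hcar hB hp ha ha₀ hRos hsplit

end Summit.HodgeConjecture.HodgeConjecture.Ring2.SemiregularRepresentatives

end
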